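import Literature.Barriers.AtomisticToContinuum.OneDimensionalHardCoreLowerBound
import Mathlib.MeasureTheory.Integral.Prod
import HarnessLib

/-!
# The Girardeau gas: no one-particle mode holds more than `c₀(N) ≤ 4e√N` particles

`Literature/Barriers/AtomisticToContinuum` (D-0021 barrier catalogue, conjunct
`BoseEinsteinCondensation`). Companion of `OneDimensionalHardCore.lean` (statement file),
`OneDimensionalHardCoreNarrow.lean` (the quadratic form `girardeauForm N L φ = ⟨φ, γ_N φ⟩` and the
uniform `εN` mode bound) and `OneDimensionalHardCoreToeplitz.lean` /
`OneDimensionalHardCoreLowerBound.lean` (Lenard's formula `ρ_{n+1}(a, b) = L⁻¹ R(n, 2π(a-b)/L)` and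
the Szegő–Lenard order `e^{-3/4}√(N+1) ≤ c₀(N) ≤ 4e√N`).

This file (sixth barrier audit, 2026-08-16) types the Fourier / Schur step that the catalogue
entry `OneDimensionalHardCoreSqrt` lists as untyped in its caveat (d) ("`λ_max = c₀` … rests on
`ρ_N^C ≥ 0` plus an untyped Fourier step"): for EVERY mode `φ` with `|φ|²` integrable on `[0, L]`,

  `|⟨φ, γ_N φ⟩| ≤ c₀(N) ‖φ‖²`  (`norm_girardeauForm_le_zeroMomentumOccupation`),

i.e. `λ_max(γ_N) ≤ c₀(N)` (with equality at the constant mode, `girardeauForm_const_one`), hence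

  `|⟨φ, γ_N φ⟩| ≤ 4e√N ‖φ‖²`  for all `N`, `L` and all modes (`norm_girardeauForm_le_sqrt`):

the `√N` calibre of the printed law [ForresterEtAl2003, §2.2.2 and §3.1] holds in the tree for the
largest eigenvalue of the one-body density matrix, not only for the zero-momentum occupation, and
without any limit. The proof is the Schur test: `ρ_N ≥ 0` (`girardeauDensityMatrix_nonneg`), the
symmetric AM–GM inequality `|φ(x)| ρ |φ(y)| ≤ ρ|φ(x)|²/2 + ρ|φ(y)|²/2`, and the fact that the row
AND column integrals of `ρ_N` over `[0, L]` all equal `c₀(N)` (translation invariance and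
periodicity of Lenard's determinant, `girardeauDensityMatrix_eq_lenardDet`,
`zeroMomentumOccupation_succ_eq_integral`); the column term needs one Fubini swap on `[0, L]²`,
for the integrand `ρ_N(x, y)|φ(y)|²`, continuous in `x, y` times integrable in `y`.

## References

* [ForresterEtAl2003] P. J. Forrester, N. E. Frankel, T. M. Garoni, N. S. Witte, Phys. Rev. A 67
  (2003) 043607, arXiv:cond-mat/0211126: §3.1 (on the circle the natural orbitals are the plane
  waves, occupations = momentum distribution), §2.2.2 (`λ₀ = c₀(N) ∼ 1.5427√N`).
* [DeiftItsKrasovsky2013] P. Deift, A. Its, I. Krasovsky, Comm. Pure Appl. Math. 66 (2013),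
  arXiv:1207.4990: Remark 8 ("A simple calculation shows that `λ^{(max)}_{N,L} = ρ^{(0)}_{N,L}`").

## Design notes

No definition and no named fact is introduced; every result is a `theorem` about the objects of the
statement file and of the Narrow companion (`girardeauForm`, `modeNormSq`).
-/

noncomputable section

open MeasureTheory Filter Topology Finset Complex
open scoped BigOperators Real ComplexConjugate

namespace Literature.Barriers.AtomisticToContinuum.BoseGas

variable {L : ℝ}

/-! ### Row and column integrals of the one-body density matrix -/

/-- **Row integrals**: `∫₀ᴸ ρ_N(x, y) dy = c₀(N)` for every `x` (translation invariance on the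
ring: `ρ_{n+1}(x, y) = L⁻¹R(n, 2π(x-y)/L)` with `R(n, ·)` `2π`-periodic).
[cite: ForresterEtAl2003, §2.2.1] -/
theorem integral_girardeauDensityMatrix_row (hL : 0 < L) (n : ℕ) (x : ℝ) :
    ∫ y in Set.Icc 0 L, girardeauDensityMatrix (n + 1) L x y =
      zeroMomentumOccupation (n + 1) L := by
  have hper : Function.Periodic (fun u => lenardDet n (2 * π * u / L)) L := by
    intro u
    simp only
    rw [show 2 * π * (u + L) / L = 2 * π * u / L + 2 * π by field_simp]
    exact lenardDet_periodic n _
  have hc : (2 * π / L : ℝ) ≠ 0 := by positivity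
  have hscale : ∫ u in (0 : ℝ)..L, lenardDet n (2 * π * u / L) =
      L / (2 * π) * ∫ t in (0 : ℝ)..2 * π, lenardDet n t := by
    have h := intervalIntegral.integral_comp_mul_left (a := 0) (b := L) (lenardDet n) hc
    rw [mul_zero, show 2 * π / L * L = 2 * π by field_simp, smul_eq_mul] at h
    rw [show (fun u => lenardDet n (2 * π * u / L)) = fun u => lenardDet n (2 * π / L * u) from
      funext fun u => by ring_nf, h]
    field_simp
  simp_rw [girardeauDensityMatrix_eq_lenardDet hL]
  rw [integral_Icc_eq_integral_Ioc, ← intervalIntegral.integral_of_le hL.le,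
    intervalIntegral.integral_const_mul]
  have h1 : ∫ y in (0 : ℝ)..L, lenardDet n (2 * π * (x - y) / L) =
      ∫ u in x - L..x - 0, lenardDet n (2 * π * u / L) :=
    intervalIntegral.integral_comp_sub_left (fun u => lenardDet n (2 * π * u / L)) x
  rw [h1, sub_zero]
  have h2 := hper.intervalIntegral_add_eq (x - L) 0
  rw [show x - L + L = x by ring, zero_add] at h2
  rw [h2, hscale, zeroMomentumOccupation_succ_eq_integral hL n]
  field_simp

/-- **Symmetry** of the one-body density matrix, `ρ_N(x, y) = ρ_N(y, x)` (the kernel is a function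
of `x - y` and `R(n, ·)` is even: both follow from Lenard's formula with the symbol
`|e^{iθ} - e^{iα}||e^{iθ} - e^{iβ}|`, symmetric in `α, β`). [cite: ForresterEtAl2003, §2.1.2] -/
theorem girardeauDensityMatrix_comm (hL : 0 < L) (n : ℕ) (x y : ℝ) :
    girardeauDensityMatrix (n + 1) L x y = girardeauDensityMatrix (n + 1) L y x := by
  have hx := density_eq_toeplitzDet (n := n) hL x y
  have hy := density_eq_toeplitzDet (n := n) hL y x
  have hsym : lenardSymbol (2 * π * y / L) (2 * π * x / L) =
      lenardSymbol (2 * π * x / L) (2 * π * y / L) :=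
    funext fun θ => lenardSymbol_comm _ _ θ
  rw [hsym] at hy
  exact_mod_cast hx.trans hy.symm

/-- **Column integrals**: `∫₀ᴸ ρ_N(x, y) dx = c₀(N)` for every `y`. [cite: ForresterEtAl2003, §2.2.1] -/
theorem integral_girardeauDensityMatrix_col (hL : 0 < L) (n : ℕ) (y : ℝ) :
    ∫ x in Set.Icc 0 L, girardeauDensityMatrix (n + 1) L x y =
      zeroMomentumOccupation (n + 1) L := by
  simp_rw [girardeauDensityMatrix_comm hL n _ y]
  exact integral_girardeauDensityMatrix_row hL n y

/-- Joint continuity of `(x, y) ↦ ρ_N(x, y)` (from Lenard's formula). [folklore] -/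
theorem continuous_girardeauDensityMatrix_uncurry (hL : 0 < L) (n : ℕ) :
    Continuous fun p : ℝ × ℝ => girardeauDensityMatrix (n + 1) L p.1 p.2 := by
  have h : (fun p : ℝ × ℝ => girardeauDensityMatrix (n + 1) L p.1 p.2) =
      fun p : ℝ × ℝ => L⁻¹ * lenardDet n (2 * π * (p.1 - p.2) / L) := by
    funext p
    exact girardeauDensityMatrix_eq_lenardDet hL p.1 p.2
  rw [h]
  exact continuous_const.mul ((continuous_lenardDet n).comp (by fun_prop))

/-- The uniform bound `ρ_N(x, y) ≤ (N/L)e^{1/2}` on `[0, L]²`. [folklore] -/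
theorem girardeauDensityMatrix_le_const (hL : 0 < L) (n : ℕ) {x y : ℝ} (hx : x ∈ Set.Icc 0 L)
    (hy : y ∈ Set.Icc 0 L) :
    girardeauDensityMatrix (n + 1) L x y ≤ (n + 1 : ℝ) / L * Real.exp (1 / 2) := by
  have h := girardeauDensityMatrix_le_majorant (n := n) hL hx hy
  have h1 := majorant_le_one L (n + 1) x y
  have h0 : 0 ≤ (n + 1 : ℝ) / L * Real.exp (1 / 2) := by positivity
  calc girardeauDensityMatrix (n + 1) L x y
      ≤ (n + 1 : ℝ) / L * Real.exp (1 / 2) * majorant L (n + 1) x y := h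
    _ ≤ (n + 1 : ℝ) / L * Real.exp (1 / 2) * 1 := by gcongr
    _ = (n + 1 : ℝ) / L * Real.exp (1 / 2) := mul_one _

/-! ### The Schur bound `λ_max ≤ c₀` -/

/-- Symmetric AM–GM: `a b ≤ a²/2 + b²/2`. [folklore] -/
theorem mul_le_half_sq_add_half_sq (a b : ℝ) : a * b ≤ a ^ 2 / 2 + b ^ 2 / 2 := by
  nlinarith [sq_nonneg (a - b)]

/-- Integrability of `(x, y) ↦ ρ_N(x, y)|φ(y)|²` on `[0, L]²` (continuous and bounded kernel times
an integrable function of `y`). [folklore] -/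
theorem integrable_density_mul_normSq (hL : 0 < L) (n : ℕ) (φ : ℝ → ℂ)
    (hφ : IntegrableOn (fun x => ‖φ x‖ ^ 2) (Set.Icc 0 L)) :
    Integrable (fun p : ℝ × ℝ => girardeauDensityMatrix (n + 1) L p.1 p.2 * ‖φ p.2‖ ^ 2)
      ((volume.restrict (Set.Icc (0 : ℝ) L)).prod (volume.restrict (Set.Icc (0 : ℝ) L))) := by
  set μ : Measure ℝ := volume.restrict (Set.Icc (0 : ℝ) L) with hμ
  have hg : Integrable (fun p : ℝ × ℝ => (n + 1 : ℝ) / L * Real.exp (1 / 2) * ‖φ p.2‖ ^ 2)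
      (μ.prod μ) := by
    have h1 : Integrable (fun y => (n + 1 : ℝ) / L * Real.exp (1 / 2) * ‖φ y‖ ^ 2) μ :=
      hφ.const_mul _
    exact h1.comp_snd μ
  refine hg.mono' ?_ ?_
  · exact ((continuous_girardeauDensityMatrix_uncurry hL n).aestronglyMeasurable).mul
      (hφ.aestronglyMeasurable.comp_snd)
  · have hmem : ∀ᵐ p : ℝ × ℝ ∂(μ.prod μ), p ∈ Set.Icc (0 : ℝ) L ×ˢ Set.Icc (0 : ℝ) L := by
      rw [hμ, Measure.prod_restrict]
      exact ae_restrict_mem (measurableSet_Icc.prod measurableSet_Icc)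
    filter_upwards [hmem] with p hp
    rw [Real.norm_eq_abs, abs_mul, abs_of_nonneg (girardeauDensityMatrix_nonneg _ _ _ _),
      abs_of_nonneg (by positivity)]
    exact mul_le_mul_of_nonneg_right (girardeauDensityMatrix_le_const hL n hp.1 hp.2)
      (by positivity)

/-- **No mode holds more than `c₀(N)` particles: `λ_max(γ_N) ≤ c₀(N)`** (Schur test). For every
`L > 0`, every `N` and every mode `φ` with `|φ|²` integrable on `[0, L]`,
`|⟨φ, γ_N φ⟩| ≤ c₀(N) ‖φ‖²`; the constant mode attains the bound (`girardeauForm_const_one`), so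
`λ_max(γ_N) = c₀(N)` — "A simple calculation shows that `λ^{(max)}_{N,L} = ρ^{(0)}_{N,L}`"
[cite: DeiftItsKrasovsky2013, Remark 8]; on the circle the natural orbitals are the plane waves
[cite: ForresterEtAl2003, §3.1]. -/
theorem norm_girardeauForm_le_zeroMomentumOccupation (hL : 0 < L) (N : ℕ) (φ : ℝ → ℂ)
    (hφ : IntegrableOn (fun x => ‖φ x‖ ^ 2) (Set.Icc 0 L)) :
    ‖girardeauForm N L φ‖ ≤ zeroMomentumOccupation N L * modeNormSq L φ := by
  cases N with
  | zero =>
    simp [girardeauForm, girardeauDensityMatrix, zeroMomentumOccupation]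
  | succ n =>
    set c : ℝ := zeroMomentumOccupation (n + 1) L with hc
    set ρ : ℝ → ℝ → ℝ := fun x y => girardeauDensityMatrix (n + 1) L x y with hρ
    have hK : IsCompact (Set.Icc (0 : ℝ) L) := isCompact_Icc
    -- integrability facts
    have hF := integrable_density_mul_normSq hL n φ hφ
    have hcol : ∀ x : ℝ, IntegrableOn (fun y => ρ x y * ‖φ y‖ ^ 2) (Set.Icc 0 L) := by
      intro x
      refine IntegrableOn.continuousOn_mul ?_ hφ hK
      exact ((continuous_girardeauDensityMatrix_uncurry hL n).comp
        (Continuous.prodMk_right x)).continuousOn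
    have hrow : ∀ x : ℝ, IntegrableOn (fun y => ρ x y * ‖φ x‖ ^ 2) (Set.Icc 0 L) := by
      intro x
      exact (((continuous_girardeauDensityMatrix_uncurry hL n).comp
        (Continuous.prodMk_right x)).mul continuous_const).integrableOn_Icc
    -- inner bound, for every `x`
    have hinner : ∀ x : ℝ,
        ‖∫ y in Set.Icc 0 L, conj (φ x) * (ρ x y : ℂ) * φ y‖ ≤
          c * ‖φ x‖ ^ 2 / 2 + (∫ y in Set.Icc 0 L, ρ x y * ‖φ y‖ ^ 2) / 2 := by
      intro x
      have hint : IntegrableOn (fun y => ρ x y * ‖φ x‖ ^ 2 / 2 + ρ x y * ‖φ y‖ ^ 2 / 2)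
          (Set.Icc 0 L) := ((hrow x).div_const 2).add ((hcol x).div_const 2)
      calc ‖∫ y in Set.Icc 0 L, conj (φ x) * (ρ x y : ℂ) * φ y‖
          ≤ ∫ y in Set.Icc 0 L, ‖conj (φ x) * (ρ x y : ℂ) * φ y‖ :=
            norm_integral_le_integral_norm _
        _ ≤ ∫ y in Set.Icc 0 L, (ρ x y * ‖φ x‖ ^ 2 / 2 + ρ x y * ‖φ y‖ ^ 2 / 2) := by
            refine integral_mono_of_nonneg (Eventually.of_forall fun y => norm_nonneg _) hint ?_
            refine Eventually.of_forall fun y => ?_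
            have hρ0 : 0 ≤ ρ x y := girardeauDensityMatrix_nonneg _ _ _ _
            show ‖conj (φ x) * (ρ x y : ℂ) * φ y‖ ≤ ρ x y * ‖φ x‖ ^ 2 / 2 + ρ x y * ‖φ y‖ ^ 2 / 2
            rw [norm_mul, norm_mul, Complex.norm_conj, Complex.norm_real, Real.norm_eq_abs,
              abs_of_nonneg hρ0]
            have h := mul_le_half_sq_add_half_sq ‖φ x‖ ‖φ y‖
            calc ‖φ x‖ * ρ x y * ‖φ y‖ = ρ x y * (‖φ x‖ * ‖φ y‖) := by ring
              _ ≤ ρ x y * (‖φ x‖ ^ 2 / 2 + ‖φ y‖ ^ 2 / 2) :=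
                  mul_le_mul_of_nonneg_left h hρ0
              _ = ρ x y * ‖φ x‖ ^ 2 / 2 + ρ x y * ‖φ y‖ ^ 2 / 2 := by ring
        _ = (∫ y in Set.Icc 0 L, ρ x y * ‖φ x‖ ^ 2 / 2) +
              ∫ y in Set.Icc 0 L, ρ x y * ‖φ y‖ ^ 2 / 2 :=
            integral_add ((hrow x).div_const 2) ((hcol x).div_const 2)
        _ = c * ‖φ x‖ ^ 2 / 2 + (∫ y in Set.Icc 0 L, ρ x y * ‖φ y‖ ^ 2) / 2 := by
            rw [integral_div, integral_div, integral_mul_const,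
              integral_girardeauDensityMatrix_row hL n x]
    -- the column term, after Fubini
    have hswap : ∫ x in Set.Icc 0 L, ∫ y in Set.Icc 0 L, ρ x y * ‖φ y‖ ^ 2 =
        c * modeNormSq L φ := by
      rw [integral_integral_swap hF]
      have h2 : ∀ y : ℝ, ∫ x in Set.Icc 0 L, ρ x y * ‖φ y‖ ^ 2 = c * ‖φ y‖ ^ 2 := by
        intro y
        rw [integral_mul_const, integral_girardeauDensityMatrix_col hL n y]
      simp_rw [h2]
      rw [integral_const_mul, modeNormSq]
    -- outer bound
    have hout1 : IntegrableOn (fun x => c * ‖φ x‖ ^ 2 / 2) (Set.Icc 0 L) :=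
      (hφ.const_mul c).div_const 2
    have hout2 : IntegrableOn (fun x => (∫ y in Set.Icc 0 L, ρ x y * ‖φ y‖ ^ 2) / 2)
        (Set.Icc 0 L) := by
      have h := hF.integral_prod_left
      exact (h.div_const 2)
    have hout : IntegrableOn
        (fun x => c * ‖φ x‖ ^ 2 / 2 + (∫ y in Set.Icc 0 L, ρ x y * ‖φ y‖ ^ 2) / 2)
        (Set.Icc 0 L) := hout1.add hout2
    calc ‖girardeauForm (n + 1) L φ‖
        ≤ ∫ x in Set.Icc 0 L, ‖∫ y in Set.Icc 0 L, conj (φ x) * (ρ x y : ℂ) * φ y‖ :=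
          norm_integral_le_integral_norm _
      _ ≤ ∫ x in Set.Icc 0 L, (c * ‖φ x‖ ^ 2 / 2 + (∫ y in Set.Icc 0 L, ρ x y * ‖φ y‖ ^ 2) / 2) :=
          integral_mono_of_nonneg (Eventually.of_forall fun x => norm_nonneg _) hout
            (Eventually.of_forall hinner)
      _ = (∫ x in Set.Icc 0 L, c * ‖φ x‖ ^ 2 / 2) +
            ∫ x in Set.Icc 0 L, (∫ y in Set.Icc 0 L, ρ x y * ‖φ y‖ ^ 2) / 2 :=
          integral_add hout1 hout2
      _ = c * modeNormSq L φ / 2 + c * modeNormSq L φ / 2 := by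
          rw [integral_div, integral_div, integral_const_mul, hswap, modeNormSq]
      _ = c * modeNormSq L φ := by ring

/-- **The `√N` law for the largest eigenvalue** (Szegő–Lenard order, all modes): for every `L > 0`,
every `N` and every mode `φ` with `|φ|²` integrable on `[0, L]`, `|⟨φ, γ_N φ⟩| ≤ 4e√N ‖φ‖²` —
no one-particle mode of the impenetrable one-dimensional Bose gas holds more than `4e√N < 11√N`
particles, for any `N`. [cite: ForresterEtAl2003, §2.2.2 and §3.1] -/
theorem norm_girardeauForm_le_sqrt (hL : 0 < L) (N : ℕ) (φ : ℝ → ℂ)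
    (hφ : IntegrableOn (fun x => ‖φ x‖ ^ 2) (Set.Icc 0 L)) :
    ‖girardeauForm N L φ‖ ≤ 4 * Real.exp 1 * Real.sqrt N * modeNormSq L φ :=
  (norm_girardeauForm_le_zeroMomentumOccupation hL N φ hφ).trans
    (mul_le_mul_of_nonneg_right (zeroMomentumOccupation_le_sqrt N hL) (modeNormSq_nonneg L φ))

end Literature.Barriers.AtomisticToContinuum.BoseGas

end
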